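import Summits.ABC.ABC.Theses.PadicPrimesYuNinety
import Summits.ABC.ABC.Theorems.PadicPrimesYuNinetyRung
import Summits.ABC.StewartYu.PrincipalUnitLatticeArith
import Literature.Barriers.ABC.BakerMethodBoundsStewartTijdemanGenericProofs
import Literature.NumberTheory.LocalFields.PadicSquareRootMinusOne
import HarnessLib

set_option linter.dupNamespace false

/-!
# Route PadicPrimesYuNinety, crux `YuNinetyOneModFour` (`p ≡ 1 (mod 4)`): the TRANSFER stub
# (Gaussian engine ⇒ crux)

`Summits/ABC/ABC/Theorems/PadicPrimesYuNinetyOneModFourTransfer.lean` — cell `abc-stewartyu`, seat p1. The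
birth skeleton of crux stmt-ABC-19250 (line `gaussian-one-plus-i`, planner g3) has two stubs:
`stub_engineGauss : GaussEngineOneModFour` (XL: Yu 1990 Thm 1 for `K = ℚ(i)` inside `ℚ_p`, generators
`1 + ι` and odd primes, output in the door's shape) and `stub_transferGauss : GaussEngineOneModFour →
YuNinetyOneModFour` (M). This file proves the transfer with the engine statement as the explicit
hypothesis `hE` (its body, verbatim): the lead's `stub_transferGauss := fun h =>
padicPrimesYuNinety_oneModFour_of_engine h` once `GaussEngineOneModFour` is an importable decl.

Stewart–Yu's device [cite: StewartYu1991, §3]: for `p ≡ 1 (mod 4)` fix `ι ∈ ℚ_p` with `ι² = −1`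
(`Literature.NumberTheory.LocalFields.padic_exists_sq_eq_neg_one`); with `u = ∏_{q ∈ S} q^{e_q}`,
`k = e₂` if `2 ∈ S` (else `0`), `S' = S ∖ {2}`: `u⁴ = (1+ι)^{8k} · ∏_{q ∈ S'} q^{4e_q}` in `ℚ_p`
(`(1+ι)⁸ = 16`), so the engine (exponents `≤ 8B`) bounds `ord_p(u⁴ − 1) ≥ ord_p(u − 1)`
(`ord_p(u+1), ord_p(u²+1) ≥ 0` for the `p`-adic unit `u`), and the garbage is absorbed by
`log (8B) ≤ 3 log B` (`B ≥ 3`), `log log (max 4 (sup S')) ≤ log log (max 4 (sup S))`,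
`∏_{S'} log (max 4 q) ≤ ∏_S log (max 4 q)` (`log 4 ≥ 1`), `(m+1)^{m+1} ≤ 4^m m^m`:
`c₅ = 12 · max(|c|,1)²`. Everything is [folklore].
-/

noncomputable section

open Finset Real

namespace Summit.ABC.ABC.Theorems

/-- `(m+1)^{m+1} ≤ 4^m · m^m` for `m ≥ 1` (`(m+1)^m ≤ (2m)^m`, `m + 1 ≤ 2^m`). [folklore] -/
theorem succ_pow_succ_le_four_pow_mul_pow {m : ℕ} (hm : 1 ≤ m) :
    ((m : ℝ) + 1) ^ (m + 1) ≤ 4 ^ m * (m : ℝ) ^ m := by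
  have hm1 : (1 : ℝ) ≤ m := by exact_mod_cast hm
  have h1 : ((m : ℝ) + 1) ^ m ≤ (2 * (m : ℝ)) ^ m :=
    pow_le_pow_left₀ (by positivity) (by linarith) m
  have h2 : (m : ℝ) + 1 ≤ 2 ^ m := by
    have : (m + 1 : ℕ) ≤ 2 ^ m := Nat.succ_le_of_lt (Nat.lt_two_pow_self)
    exact_mod_cast this
  calc ((m : ℝ) + 1) ^ (m + 1) = ((m : ℝ) + 1) ^ m * ((m : ℝ) + 1) := pow_succ _ _
    _ ≤ (2 * (m : ℝ)) ^ m * 2 ^ m := mul_le_mul h1 h2 (by positivity) (by positivity)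
    _ = 4 ^ m * (m : ℝ) ^ m := by
        rw [mul_pow, show (4 : ℝ) ^ m = 2 ^ m * 2 ^ m by rw [← mul_pow]; norm_num]
        ring

/-- **Transfer `GaussEngineOneModFour ⇒ YuNinetyOneModFour`** (the M-sized stub of the birth skeleton of
crux stmt-ABC-19250, with the engine statement as the explicit hypothesis `hE`, verbatim): a Yu-1990
bound in `ℚ(i) ⊂ ℚ_p` for the generators `1 + ι` and odd primes, already in the door's shape with `#S+1`
generators, gives the crux text for all finite sets of primes `S ∌ p` (including `2 ∈ S`) with
`c₅ = 12 · max(|c|,1)²`, via `u⁴ = (1+ι)^{8e₂} ∏_{q odd} q^{4e_q}` and `ord_p(u−1) ≤ ord_p(u⁴−1)`.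
[cite: StewartYu1991, §3] -/
theorem padicPrimesYuNinety_oneModFour_of_engine
    (hE : ∃ c : ℝ, ∀ (p : ℕ) [Fact p.Prime], p % 4 = 1 →
      ∀ ι : ℚ_[p], ι ^ 2 = -1 →
      ∀ (S : Finset ℕ), (∀ q ∈ S, q.Prime) → p ∉ S → 2 ∉ S →
      ∀ (e₀ : ℤ) (e : ℕ → ℤ) (B : ℝ), 3 ≤ B → (|e₀| : ℝ) ≤ B → (∀ q ∈ S, (|e q| : ℝ) ≤ B) →
      (1 + ι) ^ e₀ * ∏ q ∈ S, (q : ℚ_[p]) ^ e q ≠ 1 →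
      ((((1 + ι) ^ e₀ * ∏ q ∈ S, (q : ℚ_[p]) ^ e q - 1).valuation : ℤ) : ℝ) <
        (c * (S.card + 1)) ^ (S.card + 1) * (p : ℝ) ^ 2 * Real.log B *
          Real.log (Real.log ((max 4 (S.sup id) : ℕ) : ℝ)) * ∏ q ∈ S, Real.log ((max 4 q : ℕ) : ℝ)) :
    Summit.ABC.ABC.Theses.PadicPrimesYuNinety.YuNinetyOneModFour := by
  classical
  obtain ⟨c, hc⟩ := hE
  set c' : ℝ := max |c| 1 with hc'
  have hc'1 : 1 ≤ c' := le_max_right _ _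
  have hc'c : |c| ≤ c' := le_max_left _ _
  have hc'0 : 0 ≤ c' := zero_le_one.trans hc'1
  refine ⟨12 * c' ^ 2, ?_⟩
  intro p hp hp4 S hS hpS hSne e B hB heB hne1
  haveI : Fact p.Prime := ⟨hp⟩
  -- `√-1 ∈ ℚ_p`
  obtain ⟨ι, hι⟩ := Literature.NumberTheory.LocalFields.padic_exists_sq_eq_neg_one (p := p) hp4
  -- the odd part of `S`, the exponent of `2`
  set S' : Finset ℕ := S.erase 2 with hS'
  have hS'S : S' ⊆ S := Finset.erase_subset 2 S
  have hS'p : ∀ q ∈ S', q.Prime := fun q hq => hS q (hS'S hq)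
  have hpS' : p ∉ S' := fun h => hpS (hS'S h)
  have h2S' : 2 ∉ S' := Finset.notMem_erase 2 S
  set k : ℤ := if 2 ∈ S then e 2 else 0 with hk
  set e₀ : ℤ := 8 * k with he₀
  set e' : ℕ → ℤ := fun q => 4 * e q with he'
  -- sizes
  have hkB : (|k| : ℝ) ≤ B := by
    rw [hk]; split_ifs with h2
    · exact heB 2 h2
    · simp; linarith
  have hB8 : 3 ≤ 8 * B := by linarith
  have he₀B : (|e₀| : ℝ) ≤ 8 * B := by
    rw [he₀, Int.cast_mul, abs_mul]; push_cast
    rw [abs_of_pos (by norm_num : (0 : ℝ) < 8)]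
    exact mul_le_mul_of_nonneg_left hkB (by norm_num)
  have he'B : ∀ q ∈ S', (|e' q| : ℝ) ≤ 8 * B := by
    intro q hq
    simp only [he', Int.cast_mul, abs_mul]; push_cast
    rw [abs_of_pos (by norm_num : (0 : ℝ) < 4)]
    have := heB q (hS'S hq)
    have hB0 : 0 ≤ B := by linarith
    nlinarith [abs_nonneg ((e q : ℝ))]
  -- `u` and `u⁴` in `ℚ_p`
  set u : ℚ := ∏ q ∈ S, (q : ℚ) ^ e q with hu
  have hupos : 0 < u := Finset.prod_pos fun q hq => zpow_pos (by exact_mod_cast (hS q hq).pos) _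
  have hu_split : u = (2 : ℚ) ^ k * ∏ q ∈ S', (q : ℚ) ^ e q := by
    rw [hk]; split_ifs with h2
    · rw [hu, ← Finset.mul_prod_erase S _ h2]; push_cast; rfl
    · rw [zpow_zero, one_mul, hu, hS', Finset.erase_eq_of_notMem h2]
  have h16 : (1 + ι) ^ (8 : ℤ) = (2 : ℚ_[p]) ^ (4 : ℤ) := by
    have h2 : (1 + ι) ^ 2 = 2 * ι := by linear_combination hι
    have h8 : (1 + ι) ^ (8 : ℕ) = (2 : ℚ_[p]) ^ (4 : ℕ) := by
      calc (1 + ι) ^ 8 = ((1 + ι) ^ 2) ^ 4 := by ring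
        _ = (2 : ℚ_[p]) ^ 4 := by rw [h2]; linear_combination (16 * ι ^ 2 - 16) * hι
    exact_mod_cast h8
  have hX : (1 + ι) ^ e₀ * ∏ q ∈ S', (q : ℚ_[p]) ^ e' q = ((u ^ 4 : ℚ) : ℚ_[p]) := by
    have h1 : (1 + ι) ^ e₀ = (2 : ℚ_[p]) ^ (4 * k) := by
      rw [he₀, zpow_mul, h16, ← zpow_mul]
    have h2 : ∏ q ∈ S', (q : ℚ_[p]) ^ e' q = (∏ q ∈ S', (q : ℚ_[p]) ^ e q) ^ 4 := by
      rw [← Finset.prod_pow]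
      refine Finset.prod_congr rfl fun q _ => ?_
      simp only [he']
      rw [← zpow_natCast, ← zpow_mul, mul_comm]; norm_num
    rw [h1, h2, hu_split]
    push_cast
    rw [mul_pow, ← zpow_natCast ((2 : ℚ_[p]) ^ k), ← zpow_mul, mul_comm k]
    norm_num
  have hu4ne : u ^ 4 ≠ 1 := fun h =>
    hne1 ((pow_eq_one_iff_of_nonneg hupos.le (by norm_num)).mp h)
  have hXne : (1 + ι) ^ e₀ * ∏ q ∈ S', (q : ℚ_[p]) ^ e' q ≠ 1 := by
    rw [hX]; exact_mod_cast hu4ne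
  -- the engine
  have key := hc p hp4 ι hι S' hS'p hpS' h2S' e₀ e' (8 * B) hB8 he₀B he'B hXne
  rw [hX, show ((u ^ 4 : ℚ) : ℚ_[p]) - 1 = ((u ^ 4 - 1 : ℚ) : ℚ_[p]) by push_cast; ring,
    Padic.valuation_ratCast] at key
  -- `ord_p(u − 1) ≤ ord_p(u⁴ − 1)`
  have hvu : padicValRat p u = 0 := by
    rw [hu, Summit.ABC.StewartYu.PrincipalLattice.padicValRat_finset_prod _ _
      fun x hx => zpow_ne_zero _ (by exact_mod_cast (hS x hx).ne_zero)]
    refine Finset.sum_eq_zero fun x hx => ?_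
    rw [padicValRat.zpow,
      Literature.Barriers.ABC.StewartTijdemanGeneric.padicValRat_natCast_prime_of_ne hp (hS x hx)
        (fun h => hpS (h ▸ hx))]
    simp
  have hu1 : u - 1 ≠ 0 := sub_ne_zero.mpr hne1
  have hu1' : u + 1 ≠ 0 := by linarith
  have hu2 : u ^ 2 + 1 ≠ 0 := by positivity
  have hv1 : 0 ≤ padicValRat p (u + 1) := by
    have h := padicValRat.min_le_padicValRat_add (p := p) hu1'
    rw [hvu, padicValRat.one, min_self] at h; exact h
  have hv2 : 0 ≤ padicValRat p (u ^ 2 + 1) := by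
    have h := padicValRat.min_le_padicValRat_add (p := p) hu2
    rw [padicValRat.pow, hvu, mul_zero, padicValRat.one, min_self] at h; exact h
  have hvle : (padicValRat p (u - 1) : ℝ) ≤ (padicValRat p (u ^ 4 - 1) : ℝ) := by
    have h4 : u ^ 4 - 1 = (u - 1) * (u + 1) * (u ^ 2 + 1) := by ring
    have : padicValRat p (u ^ 4 - 1) =
        padicValRat p (u - 1) + padicValRat p (u + 1) + padicValRat p (u ^ 2 + 1) := by
      rw [h4, padicValRat.mul (mul_ne_zero hu1 hu1') hu2, padicValRat.mul hu1 hu1']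
    rw [this]; push_cast; linarith [(show (0:ℝ) ≤ padicValRat p (u + 1) by exact_mod_cast hv1),
      (show (0:ℝ) ≤ padicValRat p (u ^ 2 + 1) by exact_mod_cast hv2)]
  -- the garbage
  set m : ℕ := S.card with hm
  have hm1 : 1 ≤ m := Finset.card_pos.mpr hSne
  set M4 : ℝ := ((max 4 (S.sup id) : ℕ) : ℝ) with hM4
  set M4' : ℝ := ((max 4 (S'.sup id) : ℕ) : ℝ) with hM4'
  set PL : ℝ := ∏ q ∈ S, Real.log ((max 4 q : ℕ) : ℝ) with hPL
  set PL' : ℝ := ∏ q ∈ S', Real.log ((max 4 q : ℕ) : ℝ) with hPL'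
  have hlog4 : ∀ n : ℕ, (1.38 : ℝ) ≤ Real.log ((max 4 n : ℕ) : ℝ) := by
    intro n
    have h4 : (4 : ℝ) ≤ ((max 4 n : ℕ) : ℝ) := by exact_mod_cast le_max_left 4 n
    have h2 : (1.38 : ℝ) ≤ Real.log 4 := by
      have := Real.log_two_gt_d9
      have h : Real.log 4 = 2 * Real.log 2 := by
        rw [show (4 : ℝ) = 2 ^ 2 by norm_num, Real.log_pow]; norm_num
      linarith
    exact h2.trans (Real.log_le_log (by norm_num) h4)
  have hℓ : (0.27 : ℝ) ≤ Real.log (Real.log M4) := PadicPrimesYuNinetyRung.loglog_max_four_ge (S.sup id)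
  have hℓ' : (0.27 : ℝ) ≤ Real.log (Real.log M4') := PadicPrimesYuNinetyRung.loglog_max_four_ge (S'.sup id)
  have hℓle : Real.log (Real.log M4') ≤ Real.log (Real.log M4) := by
    have hsup : S'.sup id ≤ S.sup id := Finset.sup_mono hS'S
    have hle : M4' ≤ M4 := by rw [hM4, hM4']; exact_mod_cast max_le_max le_rfl hsup
    have h0 : (0 : ℝ) < M4' := by rw [hM4']; exact_mod_cast lt_of_lt_of_le (by norm_num) (le_max_left 4 _)
    have hl0 : 0 < Real.log M4' := by linarith [hlog4 (S'.sup id)]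
    exact Real.log_le_log hl0 (Real.log_le_log h0 hle)
  have hPL'0 : 0 < PL' := Finset.prod_pos fun q _ => by linarith [hlog4 q]
  have hPL0 : 0 < PL := Finset.prod_pos fun q _ => by linarith [hlog4 q]
  have hPLle : PL' ≤ PL := by
    by_cases h2 : 2 ∈ S
    · rw [hPL, ← Finset.mul_prod_erase S _ h2, ← hS']
      have h14 : (1 : ℝ) ≤ Real.log ((max 4 2 : ℕ) : ℝ) := by linarith [hlog4 2]
      exact le_mul_of_one_le_left hPL'0.le h14
    · rw [hPL', hPL, hS', Finset.erase_eq_of_notMem h2]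
  have hB0 : 0 < Real.log B := Real.log_pos (by linarith)
  have hlog8B : Real.log (8 * B) ≤ 3 * Real.log B := by
    rw [Real.log_mul (by norm_num) (by linarith)]
    have h8 : Real.log 8 ≤ Real.log (B ^ 2) :=
      Real.log_le_log (by norm_num) (by nlinarith)
    rw [Real.log_pow] at h8; push_cast at h8; linarith
  -- the constant: `(c(m'+1))^{m'+1} ≤ c' (4c' m)^m`
  obtain ⟨n', hn'⟩ : ∃ n' : ℕ, S'.card = n' := ⟨_, rfl⟩
  rw [hn'] at key
  have hn'0 : (0 : ℝ) ≤ (n' : ℝ) + 1 := by positivity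
  have hconst : (c * (n' + 1)) ^ (n' + 1) ≤ c' * (4 * c' * m) ^ m := by
    have habs : (c * (n' + 1)) ^ (n' + 1) ≤ (c' * (n' + 1)) ^ (n' + 1) := by
      have h1 : (c * ((n' : ℝ) + 1)) ^ (n' + 1) ≤ (|c| * ((n' : ℝ) + 1)) ^ (n' + 1) := by
        calc (c * ((n' : ℝ) + 1)) ^ (n' + 1) ≤ |(c * ((n' : ℝ) + 1)) ^ (n' + 1)| := le_abs_self _
          _ = (|c| * ((n' : ℝ) + 1)) ^ (n' + 1) := by rw [abs_pow, abs_mul, abs_of_nonneg hn'0]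
      have h2 : (|c| * ((n' : ℝ) + 1)) ^ (n' + 1) ≤ (c' * ((n' : ℝ) + 1)) ^ (n' + 1) :=
        pow_le_pow_left₀ (mul_nonneg (abs_nonneg c) hn'0) (mul_le_mul_of_nonneg_right hc'c hn'0) _
      exact h1.trans h2
    refine habs.trans ?_
    by_cases h2 : 2 ∈ S
    · have hcard : n' + 1 = m := by
        rw [← hn', hS', Finset.card_erase_of_mem h2, hm]; omega
      have hcardR : ((n' : ℝ) + 1) = m := by exact_mod_cast hcard
      rw [hcardR, hcard]
      have hcm0 : 0 ≤ c' * (m : ℝ) := by positivity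
      have h1 : (c' * (m : ℝ)) ^ m ≤ (4 * c' * m) ^ m :=
        pow_le_pow_left₀ hcm0 (by nlinarith) m
      exact h1.trans (le_mul_of_one_le_left (pow_nonneg (by positivity) m) hc'1)
    · have hcard : n' = m := by rw [← hn', hS', Finset.erase_eq_of_notMem h2, hm]
      rw [hcard]
      have hsucc := succ_pow_succ_le_four_pow_mul_pow hm1
      have hc'pow : 0 ≤ c' ^ (m + 1) := by positivity
      calc (c' * ((m : ℝ) + 1)) ^ (m + 1) = c' ^ (m + 1) * ((m : ℝ) + 1) ^ (m + 1) := mul_pow _ _ _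
        _ ≤ c' ^ (m + 1) * (4 ^ m * (m : ℝ) ^ m) := mul_le_mul_of_nonneg_left hsucc hc'pow
        _ = c' * (4 * c' * m) ^ m := by rw [mul_pow, mul_pow, pow_succ]; ring
  -- assemble
  have hA0 : 0 < Real.log B * Real.log (Real.log M4) * PL := mul_pos (mul_pos hB0 (by linarith)) hPL0
  set v : ℝ := (padicValRat p (u - 1) : ℝ) with hv
  have hrhs_engine : (c * (n' + 1)) ^ (n' + 1) * (p : ℝ) ^ 2 * Real.log (8 * B) *
      Real.log (Real.log M4') * PL' ≤
      (c' * (4 * c' * m) ^ m) * (p : ℝ) ^ 2 * (3 * Real.log B) * Real.log (Real.log M4) * PL := by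
    have hp2 : (0 : ℝ) ≤ (p : ℝ) ^ 2 := by positivity
    have hl8 : 0 ≤ Real.log (8 * B) := Real.log_nonneg (by linarith)
    have hK0 : 0 ≤ c' * (4 * c' * m) ^ m := by positivity
    apply mul_le_mul _ hPLle hPL'0.le (by positivity)
    apply mul_le_mul _ hℓle (by linarith) (by positivity)
    apply mul_le_mul _ hlog8B hl8 (by positivity)
    exact mul_le_mul_of_nonneg_right hconst hp2
  have hfin : (c' * (4 * c' * m) ^ m) * (p : ℝ) ^ 2 * (3 * Real.log B) * Real.log (Real.log M4) * PL ≤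
      (12 * c' ^ 2 * m) ^ m * (p : ℝ) ^ 2 * Real.log B * Real.log (Real.log M4) * PL := by
    have h3 : (3 : ℝ) * c' ≤ 3 ^ m * c' ^ m := by
      have h3m : (3 : ℝ) ≤ 3 ^ m := by
        calc (3 : ℝ) = 3 ^ 1 := (pow_one _).symm
          _ ≤ 3 ^ m := pow_le_pow_right₀ (by norm_num) hm1
      have hcm : c' ≤ c' ^ m := by
        calc c' = c' ^ 1 := (pow_one _).symm
          _ ≤ c' ^ m := pow_le_pow_right₀ hc'1 hm1
      exact mul_le_mul h3m hcm hc'0 (by positivity)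
    have hrew : (12 * c' ^ 2 * (m : ℝ)) ^ m = 3 ^ m * c' ^ m * (4 * c' * m) ^ m := by
      rw [show (12 * c' ^ 2 * (m : ℝ)) = (3 * c') * (4 * c' * m) by ring, mul_pow, mul_pow]
    rw [hrew]
    have hrest : 0 ≤ (4 * c' * (m : ℝ)) ^ m * (p : ℝ) ^ 2 * Real.log B * Real.log (Real.log M4) * PL := by
      positivity
    calc (c' * (4 * c' * m) ^ m) * (p : ℝ) ^ 2 * (3 * Real.log B) * Real.log (Real.log M4) * PL
        = (3 * c') * ((4 * c' * (m : ℝ)) ^ m * (p : ℝ) ^ 2 * Real.log B * Real.log (Real.log M4) * PL) := by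
          ring
      _ ≤ (3 ^ m * c' ^ m) * ((4 * c' * (m : ℝ)) ^ m * (p : ℝ) ^ 2 * Real.log B *
            Real.log (Real.log M4) * PL) := mul_le_mul_of_nonneg_right h3 hrest
      _ = 3 ^ m * c' ^ m * (4 * c' * m) ^ m * (p : ℝ) ^ 2 * Real.log B * Real.log (Real.log M4) * PL := by
          ring
  calc v ≤ (padicValRat p (u ^ 4 - 1) : ℝ) := hvle
    _ < (c * (n' + 1)) ^ (n' + 1) * (p : ℝ) ^ 2 * Real.log (8 * B) *
          Real.log (Real.log M4') * PL' := key
    _ ≤ (c' * (4 * c' * m) ^ m) * (p : ℝ) ^ 2 * (3 * Real.log B) * Real.log (Real.log M4) * PL :=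
        hrhs_engine
    _ ≤ (12 * c' ^ 2 * m) ^ m * (p : ℝ) ^ 2 * Real.log B * Real.log (Real.log M4) * PL := hfin

end Summit.ABC.ABC.Theorems

end
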